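import Summits.CriticalPhenomena.PercolationContinuityZ3.Theorems.PercNearOneGluingNoHeavyLowerTailFKAnalogues
import Summits.CriticalPhenomena.PercolationContinuityZ3.Theorems.PercNearOneGluingNoHeavyLowerTailFKMarkerDominanceAvoid
import Summits.CriticalPhenomena.PercolationContinuityZ3.Theorems.PercNearOneGluingNoHeavyLowerTailCSHLemmaT
import Literature.Probability.Percolation.TwoClusterGibbsCovarianceRC
import Literature.Probability.LatticeModels.RandomClusterEdgeWeightsContinuity
import HarnessLib

/-!
# FK sub-lane: the conditioned slack hierarchy for `φ_{w,q}`, `q ≥ 1` — LEMMA T, LEVEL ZERO, and the INDUCTION SKELETON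
# (`FK.CSHFK q` from the one-level unfolding step; the step itself = Lemma U_FK + Lemma H_FK is the named remaining hypothesis)

Support file (`--supports stmt-CriticalPhenomena-4575`), FK sub-lane `prim-bschramm-fk-1` (gen 2) of the post-continuity programme;
builds on p205010 (kernel theorem, internal audit signed; external expert review pending).  No definitions, no named facts, no sorries;
standard axioms.  Ports, for the random-cluster measure `φ = rcMeasureW w q ∅` (`q ≥ 1`, non-degenerate `w`), of three pieces of the
`q = 1` assembly of memo Theorem 1 (prim-hp-8 PROOF-S5-ALL-R.md §3), in fk-1's measure-parametrised vocabulary `FK.cshMarginμ` /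
`FK.decoyListμ` / `FK.obsConstμ` / `FK.covDμ` / `FK.CSHHoldsFor` / `FK.CSHFK` (`…FKAnalogues.lean`):

* `FK.cshMarginμ_nonneg_of_within_rc` — **LEMMA T for `φ_{w,q}`** (port of prim-gen-induct's `CSH.cshMargin_nonneg_of_within`): the CSH
  margin is nonnegative for every monotone `f` as soon as its WORLD-WISE version is, the worlds being `φ^ω = rcMeasureW (delW w A_Y(ω)) q ∅`
  (pairs meeting the open vertex cluster of `Y` deleted, same `q` — van den Berg–Häggström–Kahn's Lemma 2.3/2.4 for the random-cluster
  measure); this is the literature cell's rc multi-marker reduction theorem `BHK2006_multiMarkerCov_nonneg_of_within_rc` (two-block Gibbs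
  chain for `φ_{𝐩,q}`, p214387) applied to the linear form `Marg` (`CSH.cshMarg_eq_sum`);
* `FK.cshMarginμ_nil_nonneg_rc` — **LEVEL ZERO = MDL(X)_FK** (port of `CSH.cshMargin_nil_nonneg`): fk-2 gen 3's tree theorem
  `FK.markerDominanceAvoid_rc` (p216558; hull-port `T_A ≥ 0` for `φ_{w,q}`) divided by `φ(v ↮ {x} ∪ Y) > 0`;
* `FK.cshMarginμ_nonneg_of_unfold_rc`, `FK.cshHoldsFor_of_unfold_rc` — **THE INDUCTION SKELETON** (port of prim-png-lead-4576's
  `CSH.cshMargin_nonneg_of_unfold`): strong induction on the number of decoys from the ONE-LEVEL UNFOLDING STEP `hU` (for a nonempty decoy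
  list: lower-level margins nonnegative ⟹ world-wise margin nonnegative — memo Lemmas U + H), stated VERBATIM in the vocabulary of
  `FK.cshMarginμ_nonneg_of_within_rc`;
* `FK.cshFK_of_unfold` — `FK.CSHFK q` from the unfolding step at every `n` and every non-degenerate `w`.
So, for `q ≥ 1`, the FK finite leg `CSHFK q ⟹ (S5)_FK ⟹ AdditiveGluingFK q` (fk-1 gen 2 `…FKCSHToAdditiveGluing.lean`, fk-2 upper chain)
has exactly ONE remaining named hypothesis: the FK one-level unfolding step `hU` below (Lemma U_FK: world-wise unfolding / Lemma Φ by the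
domain Markov property, bookkeeping; Lemma H_FK: (K6)_rc p210469 + (Htw)_FK, bschramm/FK-Q2.md §12.6(c)).  NOTHING is asserted about it here.
[cite: VandenbergHaggstromKahn2005, §2.1 pp. 9–13, Lemmas 2.3–2.4 (p. 10), Thm. 1.3 (p. 6)] [cite: KozmaNitzan2024, Conj. 4 (p. 32)]
[cite: Grimmett2006, §1.4 eq. (1.20) (p. 15); Thm. (3.1) eq. (3.4); Thm. (3.8)]
-/

noncomputable section

namespace Summit.CriticalPhenomena.PercolationContinuityZ3.Theorems

open MeasureTheory Set Literature.Probability.LatticeModels Literature.Probability.Percolation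
open scoped Classical
open BHK2006 (delW)

namespace FK

variable {V : Type*} [Fintype V]

/-! ### Lemma T for `φ_{w,q}` -/

/-- **Lemma T for the conditioned slack hierarchy under `φ_{w,q}`, `q ≥ 1` (fixed parameters).**  Owner `x`, avoided set `Y` with
`w e < 1` on the non-loop pairs meeting `Y`, decoys `D`, observers `o, v`; `L`, `p` the decoy list and observers' constant of
`FK.cshMarginμ (rcMeasureW w q ∅)`.  IF for every monotone `g ≥ 0` the world-wise margin is nonnegative,
`0 ≤ ∫_{x↮Y} Marg_{L,p}[u ↦ ∫_{x↔u} g(C_x) dφ^ω − (∫ g(C_x) dφ^ω)·φ^ω(x↔u)] dφ(ω)`, `φ^ω = rcMeasureW (delW w A_Y(ω)) q ∅` with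
`A_Y(ω)` the pairs meeting the open vertex cluster of `Y`, THEN `0 ≤ FK.cshMarginμ (rcMeasureW w q ∅) x Y D o v f` for every monotone `f`.
(The rc multi-marker reduction theorem applied to the linear form `Marg`, coefficients `Marg[δ_u]`.)
[cite: VandenbergHaggstromKahn2005, §2.1 pp. 10–13, Lemma 2.4 (p. 10)] [cite: Grimmett2006, Thm. (3.8)] -/
theorem cshMarginμ_nonneg_of_within_rc (w : Sym2 V → unitInterval) {q : ℝ} (hq : 1 ≤ q) (x : V) (Y : Set V) (D : List V)
    (o v : V) (hY : ∀ e : Sym2 V, ¬ e.IsDiag → (∃ u ∈ e, u ∈ Y) → (w e : ℝ) < 1)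
    (hW : ∀ g : Set (Sym2 V) → ℝ, Monotone g → (∀ C, 0 ≤ g C) →
      0 ≤ ∫ ω in {ω : BondConfig V | ∀ y ∈ Y, ¬ (openGraph ω).Reachable x y},
        CSH.cshMarg (decoyListμ (rcMeasureW w q ∅) (insert x Y) D)
          (obsConstμ (rcMeasureW w q ∅) o v (insert x Y ∪ {d | d ∈ D})) o v
          (fun u => (∫ η in (openConn x u : Set (BondConfig V)), g (openEdgeCluster η x)
                ∂(rcMeasureW (delW w {e | ∃ z ∈ e, ∃ y ∈ Y, (openGraph ω).Reachable y z}) q ∅)) -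
              (∫ η, g (openEdgeCluster η x)
                ∂(rcMeasureW (delW w {e | ∃ z ∈ e, ∃ y ∈ Y, (openGraph ω).Reachable y z}) q ∅)) *
              (rcMeasureW (delW w {e | ∃ z ∈ e, ∃ y ∈ Y, (openGraph ω).Reachable y z}) q ∅).real
                (openConn x u : Set (BondConfig V)))
        ∂(rcMeasureW w q ∅))
    (f : Set (Sym2 V) → ℝ) (hf : Monotone f) :
    0 ≤ cshMarginμ (rcMeasureW w q ∅) x Y D o v f := by
  set φ := rcMeasureW w q ∅ with hφ
  set L := decoyListμ φ (insert x Y) D with hL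
  set p := obsConstμ φ o v (insert x Y ∪ {d | d ∈ D}) with hp
  set Λ : V → ℝ := fun u => CSH.cshMarg L p o v (Pi.single u 1) with hΛ
  have hmain := BHK2006_multiMarkerCov_nonneg_of_within_rc w hq x Y hY Finset.univ Λ (fun g hg hg0 => by
    have h := hW g hg hg0
    have e : ∀ ω : BondConfig V, CSH.cshMarg L p o v
        (fun u => (∫ η in (openConn x u : Set (BondConfig V)), g (openEdgeCluster η x)
              ∂(rcMeasureW (delW w {e | ∃ z ∈ e, ∃ y ∈ Y, (openGraph ω).Reachable y z}) q ∅)) -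
            (∫ η, g (openEdgeCluster η x)
              ∂(rcMeasureW (delW w {e | ∃ z ∈ e, ∃ y ∈ Y, (openGraph ω).Reachable y z}) q ∅)) *
            (rcMeasureW (delW w {e | ∃ z ∈ e, ∃ y ∈ Y, (openGraph ω).Reachable y z}) q ∅).real
              (openConn x u : Set (BondConfig V))) =
        ∑ u, Λ u * ((∫ η in (openConn x u : Set (BondConfig V)), g (openEdgeCluster η x)
              ∂(rcMeasureW (delW w {e | ∃ z ∈ e, ∃ y ∈ Y, (openGraph ω).Reachable y z}) q ∅)) -
            (∫ η, g (openEdgeCluster η x)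
              ∂(rcMeasureW (delW w {e | ∃ z ∈ e, ∃ y ∈ Y, (openGraph ω).Reachable y z}) q ∅)) *
            (rcMeasureW (delW w {e | ∃ z ∈ e, ∃ y ∈ Y, (openGraph ω).Reachable y z}) q ∅).real
              (openConn x u : Set (BondConfig V))) :=
      fun ω => CSH.cshMarg_eq_sum L p o v _
    simp only [e] at h
    exact h) f hf
  have hconc : cshMarginμ φ x Y D o v f = ∑ u, Λ u * covDμ φ x Y f u := by
    rw [cshMarginμ, ← hL, ← hp, CSH.cshMarg_eq_sum]
  rw [hconc]
  exact hmain

/-! ### Level zero: MDL(X)_FK -/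

/-- **Level zero of the FK hierarchy is MDL(X)_FK** (fk-2 gen 3's `FK.markerDominanceAvoid_rc`, divided by `φ(v ↮ {x} ∪ Y) > 0`): for
`q ≥ 1`, non-degenerate parameters, `v ∉ {x} ∪ Y`, and every monotone `f`,
`0 ≤ FK.cshMarginμ (rcMeasureW w q ∅) x Y [] o v f = cov_D(f, 1{x↔o}) − φ(o↔v | v↮{x}∪Y)·cov_D(f, 1{x↔v})`.
[cite: VandenbergHaggstromKahn2005, §2.1 (pp. 9–13), Thm. 1.3 (p. 6)] [cite: Grimmett2006, Thm. (3.1) eq. (3.4); Thm. (3.8)] -/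
theorem cshMarginμ_nil_nonneg_rc (w : Sym2 V → unitInterval) {q : ℝ} (hq : 1 ≤ q) (hw : ∀ e, 0 < w e ∧ w e < 1) (x : V)
    (Y : Set V) (o v : V) (hv : v ∉ insert x Y) (f : Set (Sym2 V) → ℝ) (hf : Monotone f) :
    0 ≤ cshMarginμ (rcMeasureW w q ∅) x Y [] o v f := by
  have hq0 : 0 < q := one_pos.trans_le hq
  set φ := rcMeasureW w q ∅ with hφ
  have hxv : x ≠ v := fun h => hv (h ▸ Set.mem_insert x Y)
  have hY : ∀ e : Sym2 V, ¬ e.IsDiag → (∃ u ∈ e, u ∈ Y) → (w e : ℝ) < 1 := fun e _ _ => unitInterval.coe_lt_one.2 (hw e).2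
  have hINV : ∀ e : Sym2 V, ((w e : unitInterval) : ℝ) = 1 → ∀ u ∈ e, u ∈ Y :=
    fun e he => absurd he (ne_of_lt (unitInterval.coe_lt_one.2 (hw e).2))
  have hmd := markerDominanceAvoid_rc w hq x v o Y hxv hY hINV f hf
  set M := φ.real {ω : BondConfig V | ∀ x' ∈ insert x Y, ¬ (openGraph ω).Reachable v x'} with hM
  set E := φ.real ({ω : BondConfig V | ∀ x' ∈ insert x Y, ¬ (openGraph ω).Reachable v x'} ∩ openConn v o) with hE
  have hMpos : 0 < M := by
    refine rcMeasureW_real_pos_of_nonempty hq0 hw ∅ ⟨∅, fun a ha hreach => ?_⟩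
    have hbot : openGraph (∅ : BondConfig V) = ⊥ := by
      unfold openGraph; exact SimpleGraph.fromEdgeSet_empty
    rw [hbot, SimpleGraph.reachable_bot] at hreach
    exact hv (hreach ▸ ha)
  -- unfold the level-zero margin
  have hset : insert x Y ∪ {d : V | d ∈ ([] : List V)} = insert x Y := by
    ext u; simp
  have hobs : obsConstμ φ o v (insert x Y ∪ {d : V | d ∈ ([] : List V)}) = E / M := by
    rw [hset]; unfold obsConstμ; rw [KNPreFKG.openConn_symm o v]
  have hmargin : cshMarginμ φ x Y [] o v f = covDμ φ x Y f o - E / M * covDμ φ x Y f v := by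
    simp only [cshMarginμ, decoyListμ, CSH.cshMarg_nil, hobs]
  rw [hmargin]
  -- `markerDominanceAvoid_rc`: `E · covD v ≤ M · covD o`
  change E * covDμ φ x Y f v ≤ M * covDμ φ x Y f o at hmd
  have h1 : M * (covDμ φ x Y f o - E / M * covDμ φ x Y f v) = M * covDμ φ x Y f o - E * covDμ φ x Y f v := by
    field_simp
  have h2 : 0 ≤ M * (covDμ φ x Y f o - E / M * covDμ φ x Y f v) := by rw [h1]; linarith
  exact nonneg_of_mul_nonneg_right h2 hMpos

/-! ### The induction skeleton -/

/-- **The FK hierarchy from the one-level unfolding step** (strong induction on the number of decoys; port of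
`CSH.cshMargin_nonneg_of_unfold`).  Fix `q ≥ 1` and non-degenerate parameters `w`.  HYPOTHESIS `hU` (= Lemmas U + H of the memo for
`φ_{w,q}`): for every datum (owner `x`, avoided set `Y`, NONEMPTY decoy list `D`, observers `o, v`, all distinct), IF every lower-level margin
`FK.cshMarginμ φ d ({x} ∪ Y ∪ pre) ds' o v h` (`D = pre ++ d :: ds'`, `h` monotone `≥ 0`) is nonnegative, THEN the world-wise margin of
`FK.cshMarginμ_nonneg_of_within_rc` (worlds `rcMeasureW (delW w A_Y(ω)) q ∅`) is nonnegative for every monotone `g ≥ 0`.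
CONCLUSION: `0 ≤ FK.cshMarginμ (rcMeasureW w q ∅) x Y D o v f` for every datum with distinct named vertices and every monotone `f`.
Level zero is `FK.cshMarginμ_nil_nonneg_rc` (MDL(X)_FK), the reduction at each level is `FK.cshMarginμ_nonneg_of_within_rc` (Lemma T_FK).
[cite: VandenbergHaggstromKahn2005, §2.1 (pp. 9–13)] [cite: KozmaNitzan2024, Conj. 4 (p. 32)] -/
theorem cshMarginμ_nonneg_of_unfold_rc (w : Sym2 V → unitInterval) {q : ℝ} (hq : 1 ≤ q) (hw : ∀ e, 0 < w e ∧ w e < 1)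
    (hU : ∀ (x : V) (Y : Set V) (D : List V) (o v : V),
      x ∉ Y → o ∉ insert x Y → v ∉ insert x Y → o ≠ v → D ≠ [] → D.Nodup → (∀ d ∈ D, d ∉ insert x Y ∧ d ≠ o ∧ d ≠ v) →
      (∀ (pre : List V) (d : V) (ds' : List V), D = pre ++ d :: ds' →
        ∀ h : Set (Sym2 V) → ℝ, Monotone h → (∀ C, 0 ≤ h C) →
          0 ≤ cshMarginμ (rcMeasureW w q ∅) d (insert x Y ∪ {e | e ∈ pre}) ds' o v h) →
      ∀ g : Set (Sym2 V) → ℝ, Monotone g → (∀ C, 0 ≤ g C) →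
      0 ≤ ∫ ω in {ω : BondConfig V | ∀ y ∈ Y, ¬ (openGraph ω).Reachable x y},
        CSH.cshMarg (decoyListμ (rcMeasureW w q ∅) (insert x Y) D)
          (obsConstμ (rcMeasureW w q ∅) o v (insert x Y ∪ {d | d ∈ D})) o v
          (fun u => (∫ η in (openConn x u : Set (BondConfig V)), g (openEdgeCluster η x)
                ∂(rcMeasureW (delW w {e | ∃ z ∈ e, ∃ y ∈ Y, (openGraph ω).Reachable y z}) q ∅)) -
              (∫ η, g (openEdgeCluster η x)
                ∂(rcMeasureW (delW w {e | ∃ z ∈ e, ∃ y ∈ Y, (openGraph ω).Reachable y z}) q ∅)) *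
              (rcMeasureW (delW w {e | ∃ z ∈ e, ∃ y ∈ Y, (openGraph ω).Reachable y z}) q ∅).real
                (openConn x u : Set (BondConfig V)))
        ∂(rcMeasureW w q ∅)) :
    ∀ (D : List V) (x : V) (Y : Set V) (o v : V),
      x ∉ Y → o ∉ insert x Y → v ∉ insert x Y → o ≠ v → D.Nodup → (∀ d ∈ D, d ∉ insert x Y ∧ d ≠ o ∧ d ≠ v) →
      ∀ f : Set (Sym2 V) → ℝ, Monotone f → 0 ≤ cshMarginμ (rcMeasureW w q ∅) x Y D o v f := by
  -- strong induction on the length of the decoy list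
  suffices hk : ∀ (k : ℕ) (D : List V), D.length ≤ k → ∀ (x : V) (Y : Set V) (o v : V),
      x ∉ Y → o ∉ insert x Y → v ∉ insert x Y → o ≠ v → D.Nodup → (∀ d ∈ D, d ∉ insert x Y ∧ d ≠ o ∧ d ≠ v) →
      ∀ f : Set (Sym2 V) → ℝ, Monotone f → 0 ≤ cshMarginμ (rcMeasureW w q ∅) x Y D o v f from
    fun D => hk D.length D le_rfl
  intro k
  induction k with
  | zero =>
    intro D hD x Y o v _ _ hv hov _ _ f hf
    have hD0 : D = [] := List.eq_nil_of_length_eq_zero (Nat.le_zero.1 hD)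
    subst hD0
    exact cshMarginμ_nil_nonneg_rc w hq hw x Y o v hv f hf
  | succ k ih =>
    intro D hD x Y o v hxY ho hv hov hnd hdis f hf
    by_cases hnil : D = []
    · subst hnil
      exact cshMarginμ_nil_nonneg_rc w hq hw x Y o v hv f hf
    -- Lemma T_FK: reduce to the world-wise margin
    have hY : ∀ e : Sym2 V, ¬ e.IsDiag → (∃ u ∈ e, u ∈ Y) → (w e : ℝ) < 1 :=
      fun e _ _ => unitInterval.coe_lt_one.2 (hw e).2
    refine cshMarginμ_nonneg_of_within_rc w hq x Y D o v hY (fun g hg hg0 => ?_) f hf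
    refine hU x Y D o v hxY ho hv hov hnil hnd hdis (fun pre d ds' hsplit h hh hh0 => ?_) g hg hg0
    -- the lower level `(d | {x} ∪ Y ∪ pre ; ds')` has fewer decoys: induction hypothesis
    have hlen : ds'.length ≤ k := by
      have : D.length = pre.length + (ds'.length + 1) := by rw [hsplit, List.length_append, List.length_cons]
      omega
    have hdD : d ∈ D := by rw [hsplit]; exact List.mem_append_right pre List.mem_cons_self
    have hpreD : ∀ e ∈ pre, e ∈ D := fun e he => by rw [hsplit]; exact List.mem_append_left _ he
    have hds'D : ∀ e ∈ ds', e ∈ D := fun e he => by rw [hsplit]; exact List.mem_append_right pre (List.mem_cons_of_mem d he)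
    -- nodup bookkeeping along `pre ++ d :: ds'`
    have hnd' : (pre ++ d :: ds').Nodup := hsplit ▸ hnd
    have hnd_ds' : ds'.Nodup := (List.nodup_cons.1 (List.nodup_append.1 hnd').2.1).2
    have hd_notin_ds' : d ∉ ds' := (List.nodup_cons.1 (List.nodup_append.1 hnd').2.1).1
    have hd_notin_pre : d ∉ pre := fun hdp =>
      (List.nodup_append.1 hnd').2.2 d hdp d List.mem_cons_self rfl
    have hds'_notin_pre : ∀ e ∈ ds', e ∉ pre := fun e he hep =>
      (List.nodup_append.1 hnd').2.2 e hep e (List.mem_cons_of_mem d he) rfl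
    -- the new avoided set
    set Y' : Set V := insert x Y ∪ {e | e ∈ pre} with hY'
    have hdY' : d ∉ Y' := by
      rintro (h1 | h2)
      · exact (hdis d hdD).1 h1
      · exact hd_notin_pre h2
    have hoY' : o ∉ insert d Y' := by
      rintro (h0 | h1 | h2)
      · exact (hdis d hdD).2.1 h0.symm
      · exact ho h1
      · exact (hdis o (hpreD o h2)).2.1 rfl
    have hvY' : v ∉ insert d Y' := by
      rintro (h0 | h1 | h2)
      · exact (hdis d hdD).2.2 h0.symm
      · exact hv h1
      · exact (hdis v (hpreD v h2)).2.2 rfl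
    have hdis' : ∀ e ∈ ds', e ∉ insert d Y' ∧ e ≠ o ∧ e ≠ v := by
      intro e he
      refine ⟨?_, (hdis e (hds'D e he)).2.1, (hdis e (hds'D e he)).2.2⟩
      rintro (h0 | h1 | h2)
      · exact hd_notin_ds' (h0 ▸ he)
      · exact (hdis e (hds'D e he)).1 h1
      · exact hds'_notin_pre e he h2
    exact ih ds' hlen d Y' o v hdY' hoY' hvY' hov hnd_ds' hdis' h hh

/-- **`FK.CSHHoldsFor (rcMeasureW w q ∅)` for every datum from the one-level unfolding step** (wrapper of
`FK.cshMarginμ_nonneg_of_unfold_rc` in the `FK.CSHHoldsFor` vocabulary, the hypothesis shape of fk-1 gen 2's peeling theorem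
`FK.s5dMarginμ_nonneg_of_cshFor`). [cite: KozmaNitzan2024, Conj. 4 (p. 32)] -/
theorem cshHoldsFor_of_unfold_rc (w : Sym2 V → unitInterval) {q : ℝ} (hq : 1 ≤ q) (hw : ∀ e, 0 < w e ∧ w e < 1)
    (hU : ∀ (x : V) (Y : Set V) (D : List V) (o v : V),
      x ∉ Y → o ∉ insert x Y → v ∉ insert x Y → o ≠ v → D ≠ [] → D.Nodup → (∀ d ∈ D, d ∉ insert x Y ∧ d ≠ o ∧ d ≠ v) →
      (∀ (pre : List V) (d : V) (ds' : List V), D = pre ++ d :: ds' →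
        ∀ h : Set (Sym2 V) → ℝ, Monotone h → (∀ C, 0 ≤ h C) →
          0 ≤ cshMarginμ (rcMeasureW w q ∅) d (insert x Y ∪ {e | e ∈ pre}) ds' o v h) →
      ∀ g : Set (Sym2 V) → ℝ, Monotone g → (∀ C, 0 ≤ g C) →
      0 ≤ ∫ ω in {ω : BondConfig V | ∀ y ∈ Y, ¬ (openGraph ω).Reachable x y},
        CSH.cshMarg (decoyListμ (rcMeasureW w q ∅) (insert x Y) D)
          (obsConstμ (rcMeasureW w q ∅) o v (insert x Y ∪ {d | d ∈ D})) o v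
          (fun u => (∫ η in (openConn x u : Set (BondConfig V)), g (openEdgeCluster η x)
                ∂(rcMeasureW (delW w {e | ∃ z ∈ e, ∃ y ∈ Y, (openGraph ω).Reachable y z}) q ∅)) -
              (∫ η, g (openEdgeCluster η x)
                ∂(rcMeasureW (delW w {e | ∃ z ∈ e, ∃ y ∈ Y, (openGraph ω).Reachable y z}) q ∅)) *
              (rcMeasureW (delW w {e | ∃ z ∈ e, ∃ y ∈ Y, (openGraph ω).Reachable y z}) q ∅).real
                (openConn x u : Set (BondConfig V)))
        ∂(rcMeasureW w q ∅))
    (x : V) (Y : Set V) (D : List V) (o v : V)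
    (hxY : x ∉ Y) (ho : o ∉ insert x Y) (hv : v ∉ insert x Y) (hov : o ≠ v) (hnd : D.Nodup)
    (hdis : ∀ d ∈ D, d ∉ insert x Y ∧ d ≠ o ∧ d ≠ v) :
    CSHHoldsFor (rcMeasureW w q ∅) x Y D o v :=
  fun f hf => cshMarginμ_nonneg_of_unfold_rc w hq hw hU D x Y o v hxY ho hv hov hnd hdis f hf

/-- **`FK.CSHFK q` from the FK one-level unfolding step at every `n` and every non-degenerate `w`** (vertex types `Fin n`, the shape
of fk-1's `FK.CSHFK`).  With fk-1 gen 2's `FK.additiveGluingFK_of_cshFK` this reduces `FK.AdditiveGluingFK q` (`q ≥ 1`) to the single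
named hypothesis `hU` (Lemma U_FK + Lemma H_FK).  NOTHING is asserted about `hU` here.
[cite: VandenbergHaggstromKahn2005, §2.1 (pp. 9–13)] [cite: KozmaNitzan2024, Conj. 4 (p. 32)] -/
theorem cshFK_of_unfold {q : ℝ} (hq : 1 ≤ q)
    (hU : ∀ (n : ℕ) (w : Sym2 (Fin n) → unitInterval), (∀ e, 0 < w e ∧ w e < 1) →
      ∀ (x : Fin n) (Y : Set (Fin n)) (D : List (Fin n)) (o v : Fin n),
      x ∉ Y → o ∉ insert x Y → v ∉ insert x Y → o ≠ v → D ≠ [] → D.Nodup → (∀ d ∈ D, d ∉ insert x Y ∧ d ≠ o ∧ d ≠ v) →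
      (∀ (pre : List (Fin n)) (d : Fin n) (ds' : List (Fin n)), D = pre ++ d :: ds' →
        ∀ h : Set (Sym2 (Fin n)) → ℝ, Monotone h → (∀ C, 0 ≤ h C) →
          0 ≤ cshMarginμ (rcMeasureW w q ∅) d (insert x Y ∪ {e | e ∈ pre}) ds' o v h) →
      ∀ g : Set (Sym2 (Fin n)) → ℝ, Monotone g → (∀ C, 0 ≤ g C) →
      0 ≤ ∫ ω in {ω : BondConfig (Fin n) | ∀ y ∈ Y, ¬ (openGraph ω).Reachable x y},
        CSH.cshMarg (decoyListμ (rcMeasureW w q ∅) (insert x Y) D)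
          (obsConstμ (rcMeasureW w q ∅) o v (insert x Y ∪ {d | d ∈ D})) o v
          (fun u => (∫ η in (openConn x u : Set (BondConfig (Fin n))), g (openEdgeCluster η x)
                ∂(rcMeasureW (delW w {e | ∃ z ∈ e, ∃ y ∈ Y, (openGraph ω).Reachable y z}) q ∅)) -
              (∫ η, g (openEdgeCluster η x)
                ∂(rcMeasureW (delW w {e | ∃ z ∈ e, ∃ y ∈ Y, (openGraph ω).Reachable y z}) q ∅)) *
              (rcMeasureW (delW w {e | ∃ z ∈ e, ∃ y ∈ Y, (openGraph ω).Reachable y z}) q ∅).real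
                (openConn x u : Set (BondConfig (Fin n))))
        ∂(rcMeasureW w q ∅)) :
    CSHFK q := by
  intro n w hw o v x Y D hov hxY hox hvx hoY hvY hD hdis
  refine cshHoldsFor_of_unfold_rc w hq hw (hU n w hw) x (↑Y : Set (Fin n)) D o v (fun h => hxY (Finset.mem_coe.1 h)) ?_ ?_ hov hD ?_
  · simp only [mem_insert_iff, Finset.mem_coe, not_or]; exact ⟨hox, hoY⟩
  · simp only [mem_insert_iff, Finset.mem_coe, not_or]; exact ⟨hvx, hvY⟩
  · intro d hd
    obtain ⟨h1, h2, h3, h4⟩ := hdis d hd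
    exact ⟨by simp only [mem_insert_iff, Finset.mem_coe, not_or]; exact ⟨h1, h2⟩, h3, h4⟩

end FK

end Summit.CriticalPhenomena.PercolationContinuityZ3.Theorems

end
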